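import Literature.NumberTheory.EllipticCurves.MultiplicativeInertiaLineProofs
import Literature.NumberTheory.EllipticCurves.DivisionFieldRamificationSquarefreeProofs
import HarnessLib

/-!
# Division fields at multiplicative places: the ramification index divides `n`, for EVERY level `n`
# prime to `v` ([IUTchIV] Prop. 1.8 (vii), second sentence, in print's strength)

`Proofs` file (theorems only: no definition, no named fact), topic `NumberTheory/EllipticCurves`;
sequel of `MultiplicativeInertiaLineProofs` (the common Tate basis of `E(K̄_v)[p^n]`) and of
`DivisionFieldRamificationProofs` / `…DividesProofs` / `…SquarefreeProofs` (`e(Q ∣ v)` is a power of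
`p`; `e ∣ p` at prime level; `e ∣ n` for squarefree `n`).

S. Mochizuki, *Inter-universal Teichmüller theory IV*, Prop. 1.8 (vii), kurims p. 19, second sentence:
"If `E_k` has bad multiplicative reduction over `O_k`, then the kernel of the action of `G_k` on `E_k[n]`
determines a tamely ramified extension of `k` whose ramification index over `k` divides `n`" (`n`
invertible in `O_k`; classical: Silverman *ATAEC* V.4–V.5, Exercise 5.13 (b); [NerMod] §7.4 Thm. 5).
GLOBAL number-field form, now for EVERY level: `E/K` elliptic over a number field, `v` a place of
multiplicative reduction, `n ≥ 1` with `(n : 𝓞 K) ∉ v`, `L ⊆ K̄` finite Galois over `K` with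
`L ⊆ K(E[n])` (`ker ρ̄_{E,n} ≤ Gal(K̄/L)`), `Q` a prime of `𝓞 L` over `v`:

* `WeierstrassCurve.exists_tateBasis_geomTorsion_of_hasMultiplicativeReductionAt` — the GLOBAL Tate
  basis: for the inertia group `I_𝔓 ≤ Γ_K` of a prime `𝔓 ∣ v` of `\bar ℤ_K` there are `P₁, P₂ ∈ E[p^k]`
  generating `E[p^k]`, `p^{k-1} P₁ ≠ O`, with every `τ ∈ I_𝔓` fixing `P₁` and `τ P₂ - P₂ ∈ ℕ P₁`
  (transport of the local theorem along `E(K̄) ↪ E(K̄_v)`, Neukirch II (9.6));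
* `Literature.NumberTheory.EllipticCurves.natCard_map_toAddAut_dvd_addOrderOf` — group theory: if a
  subgroup `I` acting on an abelian group `V = ℕ P₁ + ℕ P₂` fixes `P₁` and moves `P₂` into `ℕ P₁`, then
  its image in `Aut(V)` embeds in `ℤ P₁` (`τ ↦ τ P₂ - P₂` is an injective homomorphism), so has order
  dividing the order of `P₁`;
* `WeierstrassCurve.natCard_map_inertia_galoisRepTorsion_dvd_prime_pow` — **`#ρ̄_{E,p^k}(I_𝔓) ∣ p^k`**;
* `WeierstrassCurve.natCard_map_inertia_galoisRepTorsion_dvd` — **`#ρ̄_{E,n}(I_𝔓) ∣ n`** for every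
  `n` prime to `v` (`n = ∏ p^{k_p}`, `ker ρ̄_a ∩ ker ρ̄_b ≤ ker ρ̄_{ab}` for coprime `a, b`);
* **`WeierstrassCurve.ramificationIdx_divisionField_dvd_level_of_hasMultiplicativeReductionAt`** —
  **`e(Q ∣ v) ∣ n`**: `e(Q ∣ v) = #I_P(Gal(L/K))`, a quotient of `ρ̄_{E,n}(I_𝔓)` (the prime-level
  `…dvd_of_hasMultiplicativeReductionAt` of `…DividesProofs` and the squarefree
  `…dvd_of_squarefree` are the special cases).

Classical algebraic number theory (cell abc-iut, campaign S, node IUTchIV:Prop1.8(vii)); nothing here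
bears on [IUTchIII] Cor. 3.12.

## References

* [SilvermanATAEC1994] J. H. Silverman, *Advanced Topics in the Arithmetic of Elliptic Curves* (1994),
  V.4–V.5, Exercise 5.13 (b).
* [NeukirchANT1999] J. Neukirch, *Algebraic Number Theory* (1999), Ch. I §9 (9.6), (9.9); Ch. II (9.6).
* [Mochizuki2012] S. Mochizuki, *Inter-universal Teichmüller theory IV*, Prop. 1.8 (vii) p. 19.
-/

noncomputable section

open scoped Pointwise IntermediateField NumberField

open NumberField IsDedekindDomain IntermediateField Field

universe u

namespace Literature.NumberTheory.EllipticCurves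

/-! ### Group theory: a `(1 *; 0 1)` subgroup embeds in the line -/

/-- **A group of automorphisms of `V = ℕ P₁ + ℕ P₂` fixing `P₁` and moving `P₂` into `ℕ P₁` has order
dividing the order of `P₁`**: `τ ↦ τ P₂ - P₂` is a homomorphism `I → ℤ P₁` (the line is fixed
pointwise) whose kernel is the kernel of the action (`P₁, P₂` generate), so the image of `I` in
`Aut(V)` is isomorphic to a subgroup of the cyclic group `ℤ P₁`.
[cite: NeukirchANT1999, Ch. I §9 (9.9)] [cite: SilvermanATAEC1994, V.4–V.5 and Exercise 5.13 (b)] -/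
theorem natCard_map_toAddAut_dvd_addOrderOf {Γ V : Type*} [Group Γ] [AddCommGroup V]
    [DistribMulAction Γ V] (I : Subgroup Γ) {P₁ P₂ : V}
    (hgen : ∀ Q : V, ∃ a b : ℕ, Q = a • P₁ + b • P₂)
    (hI : ∀ τ ∈ I, τ • P₁ = P₁ ∧ ∃ m : ℕ, τ • P₂ - P₂ = m • P₁) :
    Nat.card (I.map (DistribMulAction.toAddAut Γ V)) ∣ addOrderOf P₁ := by
  classical
  set ρ := DistribMulAction.toAddAut Γ V with hρ
  -- `τ P₂ - P₂` lies on the line `ℤ P₁`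
  have hline : ∀ τ : I, (τ : Γ) • P₂ - P₂ ∈ AddSubgroup.zmultiples P₁ := fun τ ↦ by
    obtain ⟨-, m, hm⟩ := hI τ τ.2
    rw [hm, ← natCast_zsmul]
    exact AddSubgroup.zsmul_mem _ (AddSubgroup.mem_zmultiples P₁) _
  -- the line is fixed pointwise by `I`
  have hfixL : ∀ τ ∈ I, ∀ x ∈ AddSubgroup.zmultiples P₁, τ • x = x := by
    intro τ hτ x hx
    obtain ⟨k, rfl⟩ := AddSubgroup.mem_zmultiples_iff.mp hx
    rw [smul_comm τ k P₁, (hI τ hτ).1]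
  -- the homomorphism `τ ↦ τ P₂ - P₂`
  let φ : I →* Multiplicative (AddSubgroup.zmultiples P₁) :=
    { toFun := fun τ ↦ Multiplicative.ofAdd ⟨(τ : Γ) • P₂ - P₂, hline τ⟩
      map_one' := by
        apply Multiplicative.toAdd.injective
        apply Subtype.ext
        simp only [OneMemClass.coe_one, one_smul, sub_self, toAdd_ofAdd, toAdd_one,
          AddSubgroup.coe_zero]
      map_mul' := fun σ τ ↦ by
        apply Multiplicative.toAdd.injective
        apply Subtype.ext
        simp only [toAdd_ofAdd, toAdd_mul, AddSubgroup.coe_add, Subgroup.coe_mul]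
        have hστ : (σ : Γ) • ((τ : Γ) • P₂ - P₂) = (τ : Γ) • P₂ - P₂ := hfixL σ σ.2 _ (hline τ)
        rw [smul_sub] at hστ
        calc ((σ : Γ) * (τ : Γ)) • P₂ - P₂
            = ((σ : Γ) • (τ : Γ) • P₂ - (σ : Γ) • P₂) + ((σ : Γ) • P₂ - P₂) := by
              rw [mul_smul]; abel
          _ = ((σ : Γ) • P₂ - P₂) + ((τ : Γ) • P₂ - P₂) := by rw [hστ]; abel }
  -- its kernel is contained in the kernel of the action
  have hker : φ.ker ≤ ρ.ker.subgroupOf I := by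
    intro τ hτ
    rw [MonoidHom.mem_ker] at hτ
    have h2 : (τ : Γ) • P₂ = P₂ := by
      have h1 := congrArg (fun x ↦ ((Multiplicative.toAdd x : AddSubgroup.zmultiples P₁) : V)) hτ
      simp only [φ, MonoidHom.coe_mk, OneHom.coe_mk, toAdd_ofAdd, toAdd_one,
        AddSubgroup.coe_zero] at h1
      exact sub_eq_zero.mp h1
    rw [Subgroup.mem_subgroupOf, MonoidHom.mem_ker]
    refine Multiplicative.toAdd.injective (AddEquiv.ext fun Q ↦ ?_)
    show (τ : Γ) • Q = Q
    obtain ⟨a, b, rfl⟩ := hgen Q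
    rw [smul_add, smul_comm (τ : Γ) a P₁, smul_comm (τ : Γ) b P₂, (hI τ τ.2).1, h2]
  calc Nat.card (I.map ρ) = (ρ.ker.subgroupOf I).index := natCard_map_eq_index_subgroupOf ρ I
    _ ∣ φ.ker.index := Subgroup.index_dvd_of_le hker
    _ = Nat.card φ.range := Subgroup.index_ker φ
    _ ∣ Nat.card (Multiplicative (AddSubgroup.zmultiples P₁)) := Subgroup.card_subgroup_dvd_card _
    _ = Nat.card (AddSubgroup.zmultiples P₁) := Nat.card_congr Multiplicative.toAdd
    _ = addOrderOf P₁ := Nat.card_zmultiples P₁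

end Literature.NumberTheory.EllipticCurves

namespace WeierstrassCurve

open Literature.NumberTheory.EllipticCurves Literature.NumberTheory.GaloisRepresentations
  IsDedekindDomain.HeightOneSpectrum

variable {K : Type u} [Field K] [NumberField K] (W : WeierstrassCurve K)

section TateBasis

variable [W.IsElliptic]

/-- **The GLOBAL Tate basis of `E[p^n]` at a multiplicative place `v ∤ p`.**  For `E/K` elliptic,
`v` a finite place of multiplicative reduction, `p` prime with `v ∤ p`, `n ≥ 1` and a prime `𝔓 ∣ v` of
`\bar ℤ_K` with inertia group `I_𝔓 ≤ Γ_K`: there are `P₁, P₂ ∈ E[p^n] = E(K̄)[p^n]` with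
`p^{n-1} P₁ ≠ O`, generating `E[p^n]` (`Q = a P₁ + b P₂`), such that every `τ ∈ I_𝔓` fixes `P₁` and
`τ P₂ - P₂ = m P₁` for some `m ∈ ℕ`.  Transport of
`exists_tateBasis_localPoints_of_hasMultiplicativeReductionAt` along the injective equivariant map
`E(K̄) ↪ E(K̄_v)` of an embedding `ι : K̄ → K̄_v` cutting out `𝔓` (every prime above `v` is
`Γ_K`-conjugate to the one below `𝔐`; `I_𝔓` lifts into `I_𝔐`, Neukirch II (9.6); torsion points of
`E(K̄_v)` come from `E(K̄)`), exactly as in `smul_smul_sub_eq_of_mem_inertia_geomPoints`.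
[cite: SilvermanATAEC1994, V.4–V.5 and Exercise 5.13(b)] [cite: NeukirchANT1999, Ch. II §9 Prop. (9.6)] -/
theorem exists_tateBasis_geomTorsion_of_hasMultiplicativeReductionAt
    {v : HeightOneSpectrum (𝓞 K)} (hv : W.HasMultiplicativeReductionAt v) {p : ℕ} (hp : p.Prime)
    (hpv : (p : 𝓞 K) ∉ v.asIdeal) {n : ℕ} (hn : 1 ≤ n)
    {𝔓 : Ideal (absIntegers (𝓞 K) K)} (h𝔓 : 𝔓 ∈ v.primesAbove) :
    ∃ P₁ P₂ : geomTorsion W ((p ^ n : ℕ) : ℤ),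
      p ^ (n - 1) • P₁ ≠ 0 ∧
      (∀ Q : geomTorsion W ((p ^ n : ℕ) : ℤ), ∃ a b : ℕ, Q = a • P₁ + b • P₂) ∧
      ∀ τ ∈ 𝔓.inertia (absoluteGaloisGroup K), τ • P₁ = P₁ ∧ ∃ m : ℕ, τ • P₂ - P₂ = m • P₁ := by
  obtain ⟨w, hw⟩ := v.exists_spectralValuation
  obtain ⟨𝔐, h𝔐⟩ := v.localPrimesAbove_nonempty
  -- arrange `𝔓 = 𝔓_{ι,𝔐}` for an embedding `ι : K̄ → K̄_v`
  obtain ⟨g, hg⟩ := HeightOneSpectrum.exists_smul_eq_of_mem_primesAbove_holds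
    (HeightOneSpectrum.primeBelow_mem_primesAbove
      (ι := closureEmb (K := K) (v.adicCompletion K)) h𝔐) h𝔓
  set ι : AlgebraicClosure K →ₐ[K] AlgebraicClosure (v.adicCompletion K) :=
    (closureEmb (K := K) (v.adicCompletion K)).comp
      ((show AlgebraicClosure K ≃ₐ[K] AlgebraicClosure K from g⁻¹) :
        AlgebraicClosure K →ₐ[K] AlgebraicClosure K) with hι
  have h1 : 𝔓 = v.primeBelow ι 𝔐 := by
    rw [hι, HeightOneSpectrum.primeBelow_comp, ← hg]
    exact congrArg (· • _) (inv_inv g).symm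
  -- the local Tate basis and its global preimages
  obtain ⟨L₁, L₂, hL₁, hL₂, hL₁ord, hLgen, hLτ⟩ :=
    W.exists_tateBasis_localPoints_of_hasMultiplicativeReductionAt hv hp hpv hn hw h𝔐
  have hpn0 : p ^ n ≠ 0 := pow_ne_zero _ hp.ne_zero
  obtain ⟨G₁, hG₁, hG₁L⟩ := exists_pointsMapOfEmb_eq_of_nsmul_eq_zero W ι hpn0 hL₁
  obtain ⟨G₂, hG₂, hG₂L⟩ := exists_pointsMapOfEmb_eq_of_nsmul_eq_zero W ι hpn0 hL₂
  have hmem : ∀ {G : geomPoints W}, p ^ n • G = 0 → G ∈ geomTorsion W ((p ^ n : ℕ) : ℤ) :=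
    fun hG ↦ (Submodule.mem_torsionBy_iff _ _).mpr (by rw [natCast_zsmul]; exact hG)
  have hinj := pointsMapOfEmb_injective W ι
  refine ⟨⟨G₁, hmem hG₁⟩, ⟨G₂, hmem hG₂⟩, ?_, ?_, ?_⟩
  · -- `p^(n-1) P₁ ≠ 0`, read in `E(K̄_v)`
    intro h0
    apply hL₁ord
    have h0' := congrArg
      (fun R : geomTorsion W ((p ^ n : ℕ) : ℤ) ↦ pointsMapOfEmb W ι (R : geomPoints W)) h0
    simp only [AddSubmonoidClass.coe_nsmul, map_nsmul, ZeroMemClass.coe_zero, map_zero] at h0'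
    rwa [hG₁L] at h0'
  · -- generation, read in `E(K̄_v)`
    intro Q
    have hQ : p ^ n • pointsMapOfEmb W ι (Q : geomPoints W) = 0 := by
      rw [← map_nsmul, ← natCast_zsmul, (Submodule.mem_torsionBy_iff _ _).mp Q.2, map_zero]
    obtain ⟨a, b, hab⟩ := hLgen _ hQ
    refine ⟨a, b, Subtype.ext (hinj ?_)⟩
    simp only [AddSubgroup.coe_add, AddSubmonoidClass.coe_nsmul, map_add, map_nsmul, hG₁L, hG₂L]
    exact hab
  · -- the inertia group: lift `τ ∈ I_𝔓` to the local inertia group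
    intro τ hτ
    rw [h1] at hτ
    obtain ⟨σ, hσI, hσ⟩ :=
      IsDedekindDomain.HeightOneSpectrum.exists_mem_inertia_apply_eq_holds v ι h𝔐 hτ
    have hres : resGalOfEmb ι σ = τ := resGalOfEmb_eq_of_apply_eq ι hσ
    have hequiv : ∀ R : geomPoints W, pointsMapOfEmb W ι (τ • R) = σ • pointsMapOfEmb W ι R := by
      intro R
      rw [← hres]
      exact pointsMapOfEmb_smul W ι σ R
    obtain ⟨hσ₁, m, hσ₂⟩ := hLτ σ hσI
    refine ⟨Subtype.ext (hinj ?_), m, Subtype.ext (hinj ?_)⟩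
    · simp only [Literature.NumberTheory.EllipticCurves.AddSubgroup.torsionBy.coe_smul]
      rw [hequiv, hG₁L]
      exact hσ₁
    · simp only [AddSubgroupClass.coe_sub,
        Literature.NumberTheory.EllipticCurves.AddSubgroup.torsionBy.coe_smul, map_sub, map_nsmul]
      rw [hequiv, hG₁L, hG₂L]
      exact hσ₂

end TateBasis

/-! ### Images of inertia in `Aut(E[n])` -/

omit [NumberField K] in
/-- **`ρ̄_{E,1}` is trivial on any subgroup**: `E[1] = O`. [folklore] -/
private theorem natCard_map_galoisRepTorsion_one (I : Subgroup (absoluteGaloisGroup K)) :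
    Nat.card (I.map (W.galoisRepTorsion ((1 : ℕ) : ℤ))) = 1 := by
  have htriv : ∀ ν : absoluteGaloisGroup K, W.galoisRepTorsion ((1 : ℕ) : ℤ) ν = 1 := fun ν ↦ by
    refine Multiplicative.toAdd.injective (AddEquiv.ext fun P ↦ ?_)
    rw [galoisRepTorsion_apply]
    have hP : P = 0 := Subtype.ext (by
      have h := (Submodule.mem_torsionBy_iff _ _).mp P.2
      have h1 : (1 : ℤ) • (P : geomPoints W) = 0 := by rw [← Nat.cast_one (R := ℤ)]; exact h
      rwa [one_smul] at h1)
    rw [hP, smul_zero]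
    rfl
  rw [Nat.card_eq_one_iff_unique]
  refine ⟨⟨fun x y ↦ Subtype.ext ?_⟩, ⟨1⟩⟩
  obtain ⟨σ, -, hσ⟩ := x.2
  obtain ⟨τ, -, hτ⟩ := y.2
  rw [← hσ, ← hτ, htriv, htriv]

omit [NumberField K] in
/-- **The image of inertia in `Aut(E[n])` has order dividing `n = ∏_{p ∈ S} f(p)`** for pairwise
coprime levels `f(p)` each satisfying the divisibility: induction on `S` by
`ker ρ̄_a ∩ ker ρ̄_b ≤ ker ρ̄_{ab}` (`a, b` coprime). [cite: SilvermanAEC2009, Cor. III.6.4(b)] -/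
theorem natCard_map_galoisRepTorsion_dvd_prod (I : Subgroup (absoluteGaloisGroup K)) (S : Finset ℕ)
    (f : ℕ → ℕ) (hcop : ∀ p ∈ S, ∀ q ∈ S, p ≠ q → Nat.Coprime (f p) (f q))
    (hf : ∀ p ∈ S, Nat.card (I.map (W.galoisRepTorsion (f p : ℤ))) ∣ f p) :
    Nat.card (I.map (W.galoisRepTorsion ((∏ p ∈ S, f p : ℕ) : ℤ))) ∣ ∏ p ∈ S, f p := by
  classical
  induction S using Finset.induction_on with
  | empty => rw [Finset.prod_empty, W.natCard_map_galoisRepTorsion_one]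
  | insert q S hq ih =>
    have hfS : ∀ p ∈ S, Nat.card (I.map (W.galoisRepTorsion (f p : ℤ))) ∣ f p :=
      fun p hp ↦ hf p (Finset.mem_insert_of_mem hp)
    have hcopS : ∀ p ∈ S, ∀ r ∈ S, p ≠ r → Nat.Coprime (f p) (f r) :=
      fun p hp r hr ↦ hcop p (Finset.mem_insert_of_mem hp) r (Finset.mem_insert_of_mem hr)
    rw [Finset.prod_insert hq, Nat.cast_mul]
    -- `f q` is coprime to `∏_S f`
    have hc : IsCoprime (f q : ℤ) ((∏ p ∈ S, f p : ℕ) : ℤ) := by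
      rw [Int.isCoprime_iff_gcd_eq_one, Int.gcd_natCast_natCast]
      exact Nat.Coprime.prod_right fun p hp ↦
        hcop q (Finset.mem_insert_self q S) p (Finset.mem_insert_of_mem hp) (fun h ↦ hq (h ▸ hp))
    refine (natCard_map_dvd_mul_of_ker_inf_le (W.galoisRepTorsion (f q : ℤ))
      (W.galoisRepTorsion ((∏ p ∈ S, f p : ℕ) : ℤ)) _ _ ?_).trans
      (mul_dvd_mul (hf q (Finset.mem_insert_self q S)) (ih hcopS hfS))
    exact le_trans inf_le_left (W.ker_galoisRepTorsion_inf_le_of_isCoprime hc)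

section Inertia

variable [W.IsElliptic]

/-- **The image of inertia in `Aut(E[p^n])` has order dividing `p^n`** at a place `v ∤ p` of
multiplicative reduction (`𝔓 ∣ v` a prime of `\bar ℤ_K`, `I_𝔓 ≤ Γ_K`): by the global Tate basis,
`I_𝔓` fixes `P₁` and moves `P₂` into `ℕ P₁`, so its image embeds in `ℤ P₁`, of order `∣ p^n`.
[cite: SilvermanATAEC1994, V.4–V.5 and Exercise 5.13 (b)] -/
theorem natCard_map_inertia_galoisRepTorsion_dvd_prime_pow {p : ℕ} (hp : p.Prime) (n : ℕ)
    {v : HeightOneSpectrum (𝓞 K)} (hv : W.HasMultiplicativeReductionAt v) (hpv : (p : 𝓞 K) ∉ v.asIdeal)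
    {𝔓 : Ideal (absIntegers (𝓞 K) K)} (h𝔓 : 𝔓 ∈ v.primesAbove) :
    Nat.card ((𝔓.inertia (absoluteGaloisGroup K)).map (W.galoisRepTorsion ((p ^ n : ℕ) : ℤ))) ∣
      p ^ n := by
  rcases Nat.eq_zero_or_pos n with rfl | hn
  · rw [pow_zero, W.natCard_map_galoisRepTorsion_one]
  · obtain ⟨P₁, P₂, -, hgen, hI⟩ :=
      W.exists_tateBasis_geomTorsion_of_hasMultiplicativeReductionAt hv hp hpv hn h𝔓
    have hord : addOrderOf P₁ ∣ p ^ n := by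
      refine addOrderOf_dvd_of_nsmul_eq_zero (Subtype.ext ?_)
      rw [AddSubmonoidClass.coe_nsmul, ZeroMemClass.coe_zero, ← natCast_zsmul]
      exact (Submodule.mem_torsionBy_iff _ _).mp P₁.2
    exact (natCard_map_toAddAut_dvd_addOrderOf (𝔓.inertia (absoluteGaloisGroup K)) hgen hI).trans hord

/-- **The image of inertia in `Aut(E[n])` has order dividing `n`** for every `n` with `(n : 𝓞 K) ∉ v`
(`v` multiplicative): `n = ∏ p^{k_p}` over its prime factors, each `p ∤ v`, and
`natCard_map_inertia_galoisRepTorsion_dvd_prime_pow`. [cite: SilvermanATAEC1994, V.4–V.5 and Exercise 5.13 (b)] -/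
theorem natCard_map_inertia_galoisRepTorsion_dvd {n : ℕ}
    {v : HeightOneSpectrum (𝓞 K)} (hv : W.HasMultiplicativeReductionAt v) (hnv : (n : 𝓞 K) ∉ v.asIdeal)
    {𝔓 : Ideal (absIntegers (𝓞 K) K)} (h𝔓 : 𝔓 ∈ v.primesAbove) :
    Nat.card ((𝔓.inertia (absoluteGaloisGroup K)).map (W.galoisRepTorsion (n : ℤ))) ∣ n := by
  have hn : n ≠ 0 := by
    rintro rfl
    exact hnv (by rw [Nat.cast_zero]; exact v.asIdeal.zero_mem)
  have hfac : (∏ p ∈ n.primeFactors, p ^ n.factorization p : ℕ) = n :=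
    (Nat.prod_primeFactors_pow_factorization hn).symm
  have hSv : ∀ p ∈ n.primeFactors, (p : 𝓞 K) ∉ v.asIdeal := by
    intro p hp hpv
    obtain ⟨m, hm⟩ := Nat.dvd_of_mem_primeFactors hp
    apply hnv
    rw [hm, Nat.cast_mul]
    exact v.asIdeal.mul_mem_right _ hpv
  have h := W.natCard_map_galoisRepTorsion_dvd_prod (𝔓.inertia (absoluteGaloisGroup K))
    n.primeFactors (fun p ↦ p ^ n.factorization p)
    (fun p hp q hq hpq ↦ (Nat.coprime_pow_primes _ _ (Nat.prime_of_mem_primeFactors hp)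
      (Nat.prime_of_mem_primeFactors hq) hpq))
    (fun p hp ↦ by
      simpa only [Nat.cast_pow] using W.natCard_map_inertia_galoisRepTorsion_dvd_prime_pow
        (Nat.prime_of_mem_primeFactors hp) (n.factorization p) hv (hSv p hp) h𝔓)
  rwa [hfac] at h

/-- **[IUTchIV] Prop. 1.8 (vii), second sentence, at EVERY level `n` prime to `v`**: for `E/K` elliptic
over a number field, `L ⊆ K(E[n])` finite Galois over `K` (`ker ρ̄_{E,n} ≤ Gal(K̄/L)`), `v` a place
of multiplicative reduction with `(n : 𝓞 K) ∉ v` ("`n` invertible in `O_k`"), the ramification index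
of every prime `Q` of `𝓞 L` over `v` DIVIDES `n` (and is prime to the residue characteristic:
`not_dvd_ramificationIdx_divisionField_of_hasMultiplicativeReductionAt`, i.e. `L/K` is tamely
ramified at `v`).  Indeed `e(Q ∣ v) = #I_P(Gal(L/K))` (`P = 𝔓 ∩ 𝓞 L`), every element of
`I_P(Gal(L/K))` is the restriction of an element of `I_𝔓` (`exists_mem_inertia_restrict_eq`), the
restriction of `I_𝔓` to `L` is a quotient of its image in `Aut(E[n])` (`ker ρ̄ ≤ Gal(K̄/L)`), and that
image has order dividing `n`. [cite: Mochizuki2012, IUTchIV Prop 1.8 (vii) p.19]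
[cite: SilvermanATAEC1994, V.4–V.5 and Exercise 5.13 (b)] [cite: NeukirchANT1999, Ch. I §9 (9.6), (9.9)] -/
theorem ramificationIdx_divisionField_dvd_level_of_hasMultiplicativeReductionAt {n : ℕ}
    (L : IntermediateField K (AlgebraicClosure K)) [FiniteDimensional K L] [IsGalois K L]
    (hL : (W.galoisRepTorsion (n : ℤ)).ker ≤ L.fixingSubgroup)
    {v : HeightOneSpectrum (𝓞 K)} (hv : W.HasMultiplicativeReductionAt v) (hnv : (n : 𝓞 K) ∉ v.asIdeal)
    (Q : Ideal (𝓞 L)) [Q.IsPrime] [Q.LiesOver v.asIdeal] :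
    Q.ramificationIdx (𝓞 K) ∣ n := by
  obtain ⟨𝔓, h𝔓⟩ := HeightOneSpectrum.primesAbove_nonempty v
  rw [@ramificationIdx_eq_card_inertia_comap K _ _ L _ _ v 𝔓 h𝔓.1 h𝔓.2 Q _ _]
  -- (1) `I_P(Gal(L/K)) ≤` the restriction of `I_𝔓` to `L`
  set r : (AlgebraicClosure K ≃ₐ[K] AlgebraicClosure K) →* (L ≃ₐ[K] L) :=
    AlgEquiv.restrictNormalHom L with hr
  have h1 : (𝔓.comap (ringOfIntegersToIntegralClosure (k := K) (Ω := AlgebraicClosure K) L)).inertia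
      (L ≃ₐ[K] L) ≤ (𝔓.inertia (absoluteGaloisGroup K)).map r := by
    intro g hg
    obtain ⟨σ, hσ, hσg⟩ := @exists_mem_inertia_restrict_eq K _ _ L _ _ 𝔓 h𝔓.1 g hg
    refine ⟨σ, hσ, AlgEquiv.ext fun x ↦ Subtype.ext ?_⟩
    rw [hr, AlgEquiv.restrictNormalHom_apply]
    exact hσg x
  -- (2) the restriction of `I_𝔓` to `L` is a quotient of its image in `Aut(E[n])`
  have h2 : Nat.card ((𝔓.inertia (absoluteGaloisGroup K)).map r) ∣
      Nat.card ((𝔓.inertia (absoluteGaloisGroup K)).map (W.galoisRepTorsion (n : ℤ))) := by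
    refine natCard_map_dvd_of_ker_inf_le _ _ _ (le_trans inf_le_left (le_trans hL ?_))
    rw [hr, IntermediateField.restrictNormalHom_ker]
  exact (Subgroup.card_dvd_of_le h1).trans
    (h2.trans (W.natCard_map_inertia_galoisRepTorsion_dvd hv hnv h𝔓))

end Inertia

end WeierstrassCurve

end
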